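import Mathlib
import HarnessLib

/-!
# Support lemmas for `stub_mbb_of_boxInputs` (line `Sketch`, crux `SplitBlockJacobiCorner`,
# stmt-Parity-15002): the block lemma (removing a product cut by short sub-intervals)

Pure finite combinatorics, kernel-free.  A Type-II piece of the Vaughan decomposition lives on a
dyadic block `m ∈ (M,2M]`, `r ∈ (R,2R]` with a PRODUCT CUT `P < mr ≤ t`, while the Type-II
hypothesis K2′ is stated for the full block with product coefficients `α(m)γ(r)`.  Splitting `m` into
`W` consecutive sub-intervals of length `s = ⌊M/W⌋ + 1` and replacing, on the `k`-th sub-interval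
`(m_k, m_{k+1}]`, the cut by the `m`-free condition `P < (m_k+1)·r ∧ m_{k+1}·r ≤ t` costs only the
terms with `mr` in the two windows `(P, P + P/W]` and `(t − t/W, t]` (`block_bound`); the number of
pairs `(m,r)` with `mr = n` is at most `τ(n)` (`sum_block_window_le`).

* `sum_Ioc_eq_sum_range_sum_Ioc` — splitting `(c₀, c_K]` at monotone cut points;
* `cut_mono`, …, `inWindow_of_cut` — the cut points `min (M + k s) (2M)` and the window arithmetic;
* `block_bound` — the block lemma;
* `sum_block_window_le` — fibre count `#{(m,r) : mr = n} ≤ τ(n)` for the window terms.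
-/

noncomputable section

open Finset

namespace Summit.Parity.BatemanHorn.Cruxes.SplitBlockJacobiCorner.Sketch.MbbOfBoxInputs

/-- Splitting a sum over `(c 0, c K]` at monotone cut points `c 0 ≤ c 1 ≤ … ≤ c K`. [folklore] -/
theorem sum_Ioc_eq_sum_range_sum_Ioc {β : Type*} [AddCommMonoid β] (f : ℕ → β) (c : ℕ → ℕ)
    (hc : Monotone c) (K : ℕ) :
    ∑ i ∈ Ioc (c 0) (c K), f i = ∑ k ∈ range K, ∑ i ∈ Ioc (c k) (c (k + 1)), f i := by
  induction K with
  | zero => simp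
  | succ K ih =>
    rw [Finset.sum_range_succ, ← ih]
    exact (Finset.sum_Ioc_consecutive f (hc (Nat.zero_le K)) (hc (Nat.le_succ K))).symm

/-- The cut points of the block lemma, `cut k = min (M + k s) (2M)`, are monotone in `k`. [folklore] -/
theorem cut_mono (M s : ℕ) : Monotone (fun k => min (M + k * s) (2 * M)) := fun _ _ hij =>
  min_le_min (Nat.add_le_add_left (Nat.mul_le_mul_right s hij) M) le_rfl

/-- `cut 0 = M`. [folklore] -/
theorem cut_zero (M s : ℕ) : min (M + 0 * s) (2 * M) = M := by omega

/-- `M ≤ cut k ≤ 2M`. [folklore] -/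
theorem le_cut (M s k : ℕ) : M ≤ min (M + k * s) (2 * M) ∧ min (M + k * s) (2 * M) ≤ 2 * M :=
  ⟨le_min (Nat.le_add_right _ _) (by omega), min_le_right _ _⟩

/-- Consecutive cut points differ by at most `s`. [folklore] -/
theorem cut_succ_le (M s k : ℕ) : min (M + (k + 1) * s) (2 * M) ≤ min (M + k * s) (2 * M) + s := by
  rcases le_total (M + k * s) (2 * M) with h | h
  · rw [min_eq_left h]
    exact (min_le_left _ _).trans (by rw [Nat.succ_mul]; omega)
  · rw [min_eq_right h]
    exact (min_le_right _ _).trans (Nat.le_add_right _ _)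

/-- With `s = ⌊M/W⌋ + 1` and `W ≥ 1`, the `W`-th cut point is `2M`. [folklore] -/
theorem cut_W (M W : ℕ) (hW : 1 ≤ W) : min (M + W * (M / W + 1)) (2 * M) = 2 * M := by
  apply min_eq_right
  have h1 : M < W * (M / W + 1) := by
    rw [Nat.mul_add, mul_one]
    have := Nat.div_add_mod M W
    have := Nat.mod_lt M (by omega : 0 < W)
    omega
  nlinarith

/-- The arithmetic heart of the block lemma: on the `k`-th sub-interval, a pair `(m, r)` satisfying
the exact cut `P < mr ≤ t` but not the `m`-free condition has `mr` in one of the two windows.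
[folklore] -/
theorem inWindow_of_cut {M W s P t k m r : ℕ} (hW : 1 ≤ W) (hs : s = M / W + 1)
    (hm1 : min (M + k * s) (2 * M) < m) (hm2 : m ≤ min (M + (k + 1) * s) (2 * M)) (hP : P < m * r)
    (ht : m * r ≤ t)
    (hE : ¬ (P < (min (M + k * s) (2 * M) + 1) * r ∧ min (M + (k + 1) * s) (2 * M) * r ≤ t)) :
    (P < m * r ∧ m * r ≤ P + P / W) ∨ (m * r ≤ t ∧ t < m * r + t / W) := by
  have hsucc := cut_succ_le M s k
  have hMk : M ≤ min (M + k * s) (2 * M) := (le_cut M s k).1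
  have hdivW : M / W * W ≤ M := Nat.div_mul_le_self M W
  rw [not_and_or, not_lt, not_le] at hE
  rcases hE with hA | hB
  · -- `(m_k + 1) r ≤ P`: then `mr ≤ P + ⌊M/W⌋ r ≤ P + ⌊P/W⌋`
    left
    refine ⟨hP, ?_⟩
    have h1 : m * r ≤ (min (M + k * s) (2 * M) + 1) * r + (M / W) * r := by
      have : m ≤ min (M + k * s) (2 * M) + 1 + M / W := by omega
      nlinarith
    have h2 : M / W * r ≤ P / W := by
      rw [Nat.le_div_iff_mul_le (by omega)]
      calc M / W * r * W = (M / W * W) * r := by ring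
        _ ≤ (min (M + k * s) (2 * M) + 1) * r := Nat.mul_le_mul_right r (by omega)
        _ ≤ P := hA
    omega
  · -- `t < m_{k+1} r`: then `t < mr + ⌊M/W⌋ r ≤ mr + ⌊t/W⌋`
    right
    refine ⟨ht, ?_⟩
    have h1 : min (M + (k + 1) * s) (2 * M) * r ≤ m * r + (M / W) * r := by
      have : min (M + (k + 1) * s) (2 * M) ≤ m + M / W := by omega
      nlinarith
    have h2 : M / W * r ≤ t / W := by
      rw [Nat.le_div_iff_mul_le (by omega)]
      calc M / W * r * W = (M / W * W) * r := by ring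
        _ ≤ m * r := Nat.mul_le_mul_right r (by omega)
        _ ≤ t := ht
    omega

/-- **The block lemma.** Let `G : ℕ → ℂ` and unit-bounded coefficients `a, c`.  If every product
form `Σ_{m ∈ (M,2M]} Σ_{r ∈ (R,2R]} α(m)γ(r)G(mr)` with unit-bounded `α, γ` has norm `≤ Y`, then the
CUT sum `Σ_{m,r : P < mr ≤ t} a(m)c(r)G(mr)` has norm at most `W·Y` plus the window terms
`Σ_{m,r : mr ∈ windows} ‖G(mr)‖` (`W ≥ 1` sub-intervals of `m`; the windows are `(P, P + ⌊P/W⌋]` and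
`(t − ⌊t/W⌋, t]`, written without subtraction). [folklore] -/
theorem block_bound (G : ℕ → ℂ) (a c : ℕ → ℂ) (ha : ∀ m, ‖a m‖ ≤ 1) (hc : ∀ r, ‖c r‖ ≤ 1)
    (M R P t W : ℕ) (hW : 1 ≤ W) {Y : ℝ}
    (H : ∀ α γ : ℕ → ℂ, (∀ m, ‖α m‖ ≤ 1) → (∀ r, ‖γ r‖ ≤ 1) →
      ‖∑ m ∈ Ioc M (2 * M), ∑ r ∈ Ioc R (2 * R), α m * γ r * G (m * r)‖ ≤ Y) :
    ‖∑ m ∈ Ioc M (2 * M), ∑ r ∈ Ioc R (2 * R),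
        (if P < m * r ∧ m * r ≤ t then a m * c r * G (m * r) else 0)‖ ≤
      W * Y + ∑ m ∈ Ioc M (2 * M), ∑ r ∈ Ioc R (2 * R),
        (if (P < m * r ∧ m * r ≤ P + P / W) ∨ (m * r ≤ t ∧ t < m * r + t / W) then ‖G (m * r)‖
          else 0) := by
  set s := M / W + 1 with hs
  set cut : ℕ → ℕ := fun k => min (M + k * s) (2 * M) with hcut
  have hY : 0 ≤ Y := le_trans (norm_nonneg _) (H 0 0 (fun _ => by simp) (fun _ => by simp))
  -- the exact summand, the `m`-free summand on the `k`-th sub-interval, and the window majorant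
  set F : ℕ → ℕ → ℂ := fun m r => if P < m * r ∧ m * r ≤ t then a m * c r * G (m * r) else 0
    with hF
  set Fk : ℕ → ℕ → ℕ → ℂ := fun k m r =>
    if P < (cut k + 1) * r ∧ cut (k + 1) * r ≤ t then a m * c r * G (m * r) else 0 with hFk
  set Bd : ℕ → ℕ → ℝ := fun m r =>
    if (P < m * r ∧ m * r ≤ P + P / W) ∨ (m * r ≤ t ∧ t < m * r + t / W) then ‖G (m * r)‖ else 0
    with hBd
  have hBd0 : ∀ m r, 0 ≤ Bd m r := fun m r => by
    simp only [hBd]; split_ifs <;> [exact norm_nonneg _; exact le_rfl]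
  -- (1) split `m ∈ (M, 2M]` at the cut points
  have hsplit : ∀ f : ℕ → ℂ, ∑ m ∈ Ioc M (2 * M), f m =
      ∑ k ∈ range W, ∑ m ∈ Ioc (cut k) (cut (k + 1)), f m := by
    intro f
    have h := sum_Ioc_eq_sum_range_sum_Ioc f cut (cut_mono M s) W
    simp only [hcut] at h
    rwa [cut_zero, show W * s = W * (M / W + 1) from rfl, cut_W M W hW] at h
  have hsplitR : ∀ f : ℕ → ℝ, ∑ m ∈ Ioc M (2 * M), f m =
      ∑ k ∈ range W, ∑ m ∈ Ioc (cut k) (cut (k + 1)), f m := by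
    intro f
    have h := sum_Ioc_eq_sum_range_sum_Ioc f cut (cut_mono M s) W
    simp only [hcut] at h
    rwa [cut_zero, show W * s = W * (M / W + 1) from rfl, cut_W M W hW] at h
  have hsub : ∀ k, Ioc (cut k) (cut (k + 1)) ⊆ Ioc M (2 * M) := fun k => by
    intro m hm
    rw [Finset.mem_Ioc] at hm ⊢
    exact ⟨lt_of_le_of_lt (le_cut M s k).1 hm.1, hm.2.trans (le_cut M s (k + 1)).2⟩
  -- (2) main part on the `k`-th sub-interval: a product form, bounded by `Y`
  have hmain : ∀ k, ‖∑ m ∈ Ioc (cut k) (cut (k + 1)), ∑ r ∈ Ioc R (2 * R), Fk k m r‖ ≤ Y := by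
    intro k
    set α : ℕ → ℂ := fun m => if m ∈ Ioc (cut k) (cut (k + 1)) then a m else 0 with hα
    set γ : ℕ → ℂ := fun r => if P < (cut k + 1) * r ∧ cut (k + 1) * r ≤ t then c r else 0
      with hγ
    have hα1 : ∀ m, ‖α m‖ ≤ 1 := fun m => by
      simp only [hα]; split_ifs <;> [exact ha m; simp]
    have hγ1 : ∀ r, ‖γ r‖ ≤ 1 := fun r => by
      simp only [hγ]; split_ifs <;> [exact hc r; simp]
    have key : ∑ m ∈ Ioc M (2 * M), ∑ r ∈ Ioc R (2 * R), α m * γ r * G (m * r) =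
        ∑ m ∈ Ioc (cut k) (cut (k + 1)), ∑ r ∈ Ioc R (2 * R), Fk k m r := by
      rw [← Finset.sum_subset (hsub k)]
      · refine Finset.sum_congr rfl fun m hm => Finset.sum_congr rfl fun r _ => ?_
        simp only [hα, hFk, hγ, if_pos hm]
        split_ifs <;> simp
      · intro m _ hm
        refine Finset.sum_eq_zero fun r _ => ?_
        simp only [hα, if_neg hm, zero_mul]
    rw [← key]
    exact H α γ hα1 hγ1
  -- (3) the difference on the `k`-th sub-interval is supported in the windows
  have hdiff : ∀ k, ∀ m ∈ Ioc (cut k) (cut (k + 1)), ∀ r ∈ Ioc R (2 * R),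
      ‖F m r - Fk k m r‖ ≤ Bd m r := by
    intro k m hm r _
    rw [Finset.mem_Ioc] at hm
    have hG : ‖a m * c r * G (m * r)‖ ≤ ‖G (m * r)‖ := by
      rw [norm_mul, norm_mul]
      calc ‖a m‖ * ‖c r‖ * ‖G (m * r)‖ ≤ 1 * 1 * ‖G (m * r)‖ :=
            mul_le_mul_of_nonneg_right (mul_le_mul (ha m) (hc r) (norm_nonneg _) zero_le_one)
              (norm_nonneg _)
        _ = ‖G (m * r)‖ := by ring
    simp only [hF, hFk, hBd]
    by_cases hE : P < (cut k + 1) * r ∧ cut (k + 1) * r ≤ t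
    · -- the `m`-free condition implies the exact cut
      have hex : P < m * r ∧ m * r ≤ t := by
        constructor
        · exact lt_of_lt_of_le hE.1 (Nat.mul_le_mul_right r hm.1)
        · exact le_trans (Nat.mul_le_mul_right r hm.2) hE.2
      rw [if_pos hex, if_pos hE, sub_self, norm_zero]
      split_ifs <;> [exact norm_nonneg _; exact le_rfl]
    · rw [if_neg hE, sub_zero]
      by_cases hex : P < m * r ∧ m * r ≤ t
      · rw [if_pos hex, if_pos (inWindow_of_cut hW hs hm.1 hm.2 hex.1 hex.2 hE)]
        exact hG
      · rw [if_neg hex, norm_zero]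
        split_ifs <;> [exact norm_nonneg _; exact le_rfl]
  -- (4) assemble
  have hk : ∀ k ∈ range W,
      ‖∑ m ∈ Ioc (cut k) (cut (k + 1)), ∑ r ∈ Ioc R (2 * R), F m r‖ ≤
        Y + ∑ m ∈ Ioc (cut k) (cut (k + 1)), ∑ r ∈ Ioc R (2 * R), Bd m r := by
    intro k _
    have hdecomp : ∑ m ∈ Ioc (cut k) (cut (k + 1)), ∑ r ∈ Ioc R (2 * R), F m r =
        (∑ m ∈ Ioc (cut k) (cut (k + 1)), ∑ r ∈ Ioc R (2 * R), Fk k m r) +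
          ∑ m ∈ Ioc (cut k) (cut (k + 1)), ∑ r ∈ Ioc R (2 * R), (F m r - Fk k m r) := by
      rw [← Finset.sum_add_distrib]
      refine Finset.sum_congr rfl fun m _ => ?_
      rw [← Finset.sum_add_distrib]
      refine Finset.sum_congr rfl fun r _ => ?_
      ring
    rw [hdecomp]
    refine (norm_add_le _ _).trans (add_le_add (hmain k) ?_)
    refine (norm_sum_le _ _).trans (Finset.sum_le_sum fun m hm => ?_)
    exact (norm_sum_le _ _).trans (Finset.sum_le_sum fun r hr => hdiff k m hm r hr)
  calc ‖∑ m ∈ Ioc M (2 * M), ∑ r ∈ Ioc R (2 * R), F m r‖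
      = ‖∑ k ∈ range W, ∑ m ∈ Ioc (cut k) (cut (k + 1)), ∑ r ∈ Ioc R (2 * R), F m r‖ := by
        rw [hsplit]
    _ ≤ ∑ k ∈ range W, ‖∑ m ∈ Ioc (cut k) (cut (k + 1)), ∑ r ∈ Ioc R (2 * R), F m r‖ :=
        norm_sum_le _ _
    _ ≤ ∑ k ∈ range W, (Y + ∑ m ∈ Ioc (cut k) (cut (k + 1)), ∑ r ∈ Ioc R (2 * R), Bd m r) :=
        Finset.sum_le_sum hk
    _ = W * Y + ∑ m ∈ Ioc M (2 * M), ∑ r ∈ Ioc R (2 * R), Bd m r := by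
        rw [Finset.sum_add_distrib, Finset.sum_const, Finset.card_range, nsmul_eq_mul,
          ← hsplitR]

/-- **Fibre count for the window terms**: `Σ_{m ∈ (M,2M], r ∈ (R,2R], B(mr)} g(mr) ≤
Σ_{n ≤ N, B(n)} τ(n) g(n)` for `g ≥ 0` and `4MR ≤ N` (at most `τ(n)` pairs `(m,r)` with `mr = n`).
[folklore] -/
theorem sum_block_window_le (M R N : ℕ) (hN : 4 * M * R ≤ N) (B : ℕ → Prop) [DecidablePred B]
    (g : ℕ → ℝ) (hg : ∀ n, 0 ≤ g n) :
    ∑ m ∈ Ioc M (2 * M), ∑ r ∈ Ioc R (2 * R), (if B (m * r) then g (m * r) else 0) ≤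
      ∑ n ∈ (Ioc 0 N).filter B, (n.divisors.card : ℝ) * g n := by
  rw [← Finset.sum_product']
  rw [← Finset.sum_filter]
  set S := (Ioc M (2 * M) ×ˢ Ioc R (2 * R)).filter (fun p : ℕ × ℕ => B (p.1 * p.2)) with hS
  have hmaps : ∀ p ∈ S, p.1 * p.2 ∈ (Ioc 0 N).filter B := by
    intro p hp
    simp only [hS, Finset.mem_filter, Finset.mem_product, Finset.mem_Ioc] at hp
    obtain ⟨⟨⟨hm1, hm2⟩, ⟨hr1, hr2⟩⟩, hB⟩ := hp
    refine Finset.mem_filter.mpr ⟨Finset.mem_Ioc.mpr ⟨Nat.mul_pos (by omega) (by omega), ?_⟩, hB⟩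
    calc p.1 * p.2 ≤ (2 * M) * (2 * R) := Nat.mul_le_mul hm2 hr2
      _ = 4 * M * R := by ring
      _ ≤ N := hN
  rw [← Finset.sum_fiberwise_of_maps_to' hmaps]
  refine Finset.sum_le_sum fun n hn => ?_
  rw [Finset.sum_const, nsmul_eq_mul]
  refine mul_le_mul_of_nonneg_right ?_ (hg n)
  have hn0 : n ≠ 0 := by
    have := (Finset.mem_Ioc.mp (Finset.mem_filter.mp hn).1).1
    omega
  exact_mod_cast Finset.card_le_card_of_injOn (fun p : ℕ × ℕ => p.1)
    (fun p hp => by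
      simp only [Finset.coe_filter, Set.mem_setOf_eq] at hp
      rw [Finset.mem_coe, Nat.mem_divisors]
      exact ⟨⟨p.2, hp.2.symm⟩, hn0⟩)
    (fun p hp p' hp' (h : p.1 = p'.1) => by
      simp only [Finset.coe_filter, Set.mem_setOf_eq, hS, Finset.mem_filter, Finset.mem_product,
        Finset.mem_Ioc] at hp hp'
      have h1 : 0 < p.1 := by omega
      have h2 : p.1 * p.2 = p.1 * p'.2 := by rw [hp.2, ← hp'.2, h]
      exact Prod.ext h (Nat.eq_of_mul_eq_mul_left h1 h2))

end Summit.Parity.BatemanHorn.Cruxes.SplitBlockJacobiCorner.Sketch.MbbOfBoxInputs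

namespace Summit.Parity.BatemanHorn.Cruxes.SplitBlockJacobiCorner.Sketch

/-- **Registered stub form** (splitting a sum at monotone cut points, the skeleton of the block lemma): restated in
`∀`-form in the crux-line namespace under the name registered on stmt-Parity-15002. [folklore] -/
theorem mbbBlock_split :
    ∀ (f : ℕ → ℂ) (c : ℕ → ℕ), Monotone c → ∀ K : ℕ, ∑ i ∈ Finset.Ioc (c 0) (c K), f i = ∑ k ∈ Finset.range K, ∑ i ∈ Finset.Ioc (c k) (c (k + 1)), f i :=
  fun f c hc K => MbbOfBoxInputs.sum_Ioc_eq_sum_range_sum_Ioc f c hc K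

end Summit.Parity.BatemanHorn.Cruxes.SplitBlockJacobiCorner.Sketch

end
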